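import Summits.BirchSwinnertonDyer.BirchSwinnertonDyer.Theses.PrintX9
import Summits.BirchSwinnertonDyer.BirchSwinnertonDyer.Theorems.PrintX9HowardContainmentLightFrameOfPrintDepthPosLocalized
import Literature.NumberTheory.EllipticCurves.CastellaGrossiLeeSkinner2022.HowardDivisibilityAnyClassNumber
import Summits.BirchSwinnertonDyer.BirchSwinnertonDyer.Theorems.PrintX9HowardIMCLink
import Summits.BirchSwinnertonDyer.BirchSwinnertonDyer.Theorems.Rank1ResidualX9CMPartner
import Summits.BirchSwinnertonDyer.Rank1Residual.X9.TorsionDepthCoprimeClassNumber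
import HarnessLib

/-!
# Line `torsion-depth-light-ofprint` on crux `HowardContainmentLightFrameOfPrint` (route PrintX9, rev 18+)
= line `torsion-depth-light` (crux stmt-BirchSwinnertonDyer-24424 `HowardContainmentLightFrame`) with the
PRINT regime `p ∤ h_K` DISCHARGED INSIDE THE COMPOSITION from the crux's own hypotheses and the `δ > 0` regime
RE-CUT in CGLS's STABILIZED currency — the crux (rev 18 typing) is
`MastellaZermanHowardDivisibility → CGLSHowardDivisibilityLocalized → AnticyclotomicTowerInRingClassFields →
HowardContainmentLightFrame`, i.e. MZ26 Cor. 4.6 (the ∀-body of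
`MastellaZerman2026.cor46_howardDivisibility_of_scalarImage` at universe 0), CGLS22 Thm. 4.1.3 (the ∀-body of
`CastellaGrossiLeeSkinner2022.thm413_rankOne_charIdeal_torsion_dvd_localized`, lit g19 p596552, ANY class
number) and the classical tower containment `K_k ⊂ K[p^d]` ⟹ Howard's containment at every rank-one light X9
frame. The former stub `stub_coprimeClassNumber` is the sorry-free theorem `coprimeClassNumber_of_cor46`
(ty3 p596622 `X9.torsionDepthLight_stub_coprimeClassNumber_of_cor46`: `𝔖_p(K_∞)` by
`LambdaAdicSelmerDataExists.nonempty_lambdaAdicSelmerData`, the Heegner family at the GIVEN `jbar` by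
`nonempty_heegnerFamily_of ∘ exists_isHeegnerNormPoint_holds`, the Selmer dual by `nonempty_selmerDualData_holds`;
MZ26's hypothesis structure by `Rank1Residual.ClassX9.mz26Hypotheses`, the scalar condition being the THEOREM
`ClassX9.hasPadicScalarImage`). The planner's v1 (sha ec48201d46e6) had THREE registered stubs:
* `stub_depthZero_divisibleClassNumber` — `p ∣ h_K`, torsion depth `δ = 0` (`K_1 ⊄ H_K`): Howard 2004 Thm B /
  MZ26 §3 verbatim with intrinsic layers (beyond print BY NAME; Howard assumes `p ∤ h_K`, arXiv:1202.6340 p.3;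
  statement IDENTICAL to line `torsion-depth-light` stub 2 — a proof transfers verbatim).
* `stub_depthPos_localized` — `δ > 0`: the STABILIZED localized containment `p^m · I(Λκ_∞)² ⊆ char_Λ(X_tors)`
  FROM `hCGLS` + `hTw` BY NAME: `Thm413Hypotheses` from the light binders, corank one from the PROVED
  `selmerCorank_eq_mordellWeilRank_add_holds`, a `StabilizedHeegnerData` term from `hTw` +
  `finiteIndex_ringClassSubgroup` + `index_layerSubgroup` + `exists_isHeegnerNormPoint_holds`
  (PRINT modulo typing; size M).
* `stub_depthPos_muPart` — `δ > 0`: the INTEGRAL PROMOTION `p^m · I(Λκ_∞)² ⊆ char ⟹ I(ℋ_F)² ⊆ char` (μ-part +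
  envelope `ℋ_F ~ Λκ_∞`) — the genuinely open piece (HARDEST, beyond print).
v1 composition: intro `h46 hCGLS hTw`, fix the frame, `jbar := IsAlgClosed.lift` along `ιC`, split on `p ∣ h_K`, then on `δ`.
RESHAPE v3 (lead x9-p1, 2026-08-28T06:3xZ; v2 = one merged promotion stub, superseded before registration).
(i) Stub s3 `stub_depthPos_localized` is LANDED (x9-p2, p607064, `X9.torsionDepthLight_stub_depthPos_localized`);
CGLS 4.1.3 has no depth / class-number hypothesis and is a `∀ D C X` statement, so the skeleton now uses it
IN `∀`-FORM at the frame (`span_pow_mul_sq_le_charIdeal_torsion_of_thm413 hCGLS` with x9-p2's landed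
`X9.thm413Hypotheses_of_lightFrame` / `X9.selmerCorank_eq_one_of_rank_one`). (ii) The former stubs s2
(`δ = 0` Howard port) and s4 (`δ > 0` promotion) were ONE step at two depths (x9-p1-w2 STATUS 05:14Z,
x9-p2 reshape note 05:45Z = evidence #8, plan g9 PIN-1 ruling 05:20Z): AS TYPED the crux's family `F` is
∃-quantified with its OWN parametrisation datum, the tree rescales data (`HeegnerFamily.zsmul`,
`heegnerModuleLayer_zsmul`, sandwich `(C m)•ℋ(F) ≤ ℋ(m•F) ≤ ℋ(F)`), and CGLS's `p^m` is absorbed by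
`F := p^b • F₀` — so the promotion is μ-BLIND and splits into TWO registered stubs:
* `stub_envelope` — for every `Λ`-adic Selmer datum `D` at a light X9 frame there are a CGLS datum `C`, a
  tree Heegner family `F₀` ON THE FRAME'S `Dt` and `e` with `(p^e)·I(ℋ_{F₀}) ⊆ I(Λκ_∞(C))` and `𝔖/ℋ_{F₀}`
  torsion (module content: `ℋ_{F₀} ⊆ Λκ_∞(C)` up to `p^e` by the vertical distribution relations — Darmon
  Prop. 3.10 is cite-only in another vocabulary — + non-torsion of the Heegner class, CGLS Thm. 4.1.1 /
  Cornut–Vatsal, not exported by p596552; the ONE research-sized stub, L; pin-ready: `F₀.Dt = Dt`);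
* `stub_rescaling` — localized containment for a family `F₀` with `𝔖` f.g. of rank one and `𝔖/ℋ_{F₀}`
  torsion ⟹ integral containment for SOME family (`p^b • F₀`): levelwise division in `𝔖` from
  `E(K_k)[p] = 0` ((irr) up the `p`-tower) + `char(M/p^bM) ⊆ (p^b)` + multiplicativity — x9-p1-w2's road
  (p607645, p607664 landed), typing, M–L. Kernel-valid AS TYPED; NOT route currency (plan g9 R0): under
  PIN-1 (`F.Dt = Dt`, `p ∤ c(Dt)`, PrintX9 rev 20) `stub_rescaling` is replaced by the μ-part at `p ∣ h_K`
  — «`μ(char X_tors) = 0` ⟹ `I(ℋ_{F₀})² ⊆ char`» via x10b-p2's `le_charIdeal_of_span_pow_mul_le_of_muInvariant_eq_zero`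
  (p607210) — whose input `μ = 0` at `p ∣ h_K`, non-surjective image, is BEYOND PRINT (MZ26 Ass. 2.1;
  CGLS Cor. 3.4.2 / BCS25 Thm. 1.2.2 (a) rational) = the honest residual of the pinned crux.
Composition (`p ∣ h_K` branch): `D`, `X` exist; `stub_envelope` gives `(C, F₀, e)`; CGLS 4.1.3 at `(D, C, X)`
gives `𝔖` f.g. rank one and `p^m·I(Λκ_∞(C))² ⊆ char(X_tors)`; hence `p^{m+2e}·I(ℋ_{F₀})² ⊆ char(X_tors)`;
`stub_rescaling` gives `F`. The `p ∤ h_K` branch stays PRINT (`coprimeClassNumber_of_cor46 h46`).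
Cell `bsd-print-x9`, planner g8 / lead x9-p1, 2026-08-28. [cite: MastellaZerman2026, Cor. 4.6 (arXiv:2505.08710)]
[cite: CastellaGrossiLeeSkinner2022, Thm. 3.4.1 (ii), Cor. 3.4.2, Thm. 4.1.3, Rem. 4.1.4 (arXiv:2008.02571)]
[cite: Howard2004HeegnerKolyvagin, Thm. B (arXiv:1202.6340)] [cite: Fouquet2013, Thm. B (ii)]
[cite: PerrinRiou1987BSMF, §1 (K_∞ ⊂ K[p^∞])]
-/

set_option linter.dupNamespace false
set_option autoImplicit false


namespace Summit.BirchSwinnertonDyer.BirchSwinnertonDyer.Cruxes.HowardContainmentLightFrameOfPrint.TorsionDepthLight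

open Literature.NumberTheory.EllipticCurves

/-! ## Statements as named propositions (frame binders IDENTICAL to line `torsion-depth-light` on 24424) -/

/-- **Regime `p ∤ h_K`** — Howard's containment on a light X9 Heegner frame whose class number is prime to
`p`, for the GIVEN embedding `jbar`. No longer a stub: PROVED below from MZ26 Cor. 4.6 (`coprimeClassNumber_of_cor46`).
[cite: MastellaZerman2026, Cor. 4.6 (arXiv:2505.08710)] -/
def Stmt.coprimeClassNumber : Prop :=
    ∀ (W : WeierstrassCurve ℚ) [W.IsElliptic] [W.IsGloballyMinimal] (p : ℕ) [Fact p.Prime]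
      [NeZero (W.conductorNorm ℤ)] (K : Type) [Field K] [NumberField K],
      Summit.BirchSwinnertonDyer.BirchSwinnertonDyer.Rank1Residual.ClassX9 W p →
      IsImaginaryQuadratic K → Odd (NumberField.discr K) → NumberField.discr K ≠ -3 →
      SatisfiesHeegnerHypothesis (W.conductorNorm ℤ) K → SatisfiesHeegnerHypothesis p K →
      (W.baseChange K).HasIrreducibleModPGaloisRep p →
      ∀ (κ : ZpExtension K p), κ.IsAnticyclotomic → ∀ (γ : Field.absoluteGaloisGroup K),
      κ.IsTopGenerator γ →
      ∀ (Dt : ModularForms.ModularParametrizationData W (W.conductorNorm ℤ))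
        (H : HeegnerDatum (W.conductorNorm ℤ) (NumberField.discr K)) (ιC : K →+* ℂ)
        (jbar : AlgebraicClosure K →+* ℂ),
      (W.baseChange K).mordellWeilRank = 1 →
      Finite (AddCommGroup.primaryComponent (W.baseChange K).sha p) →
      ¬ p ∣ NumberField.classNumber K →
      ∃ (D : (W.baseChange K).LambdaAdicSelmerData κ γ)
        (F : HeegnerFamily (W.conductorNorm ℤ) W K κ jbar) (X : (W.baseChange K).SelmerDualData κ γ),
        heegnerCharIdeal D F ^ 2 ≤
          Module.charIdeal (IwasawaAlgebra p) (Submodule.torsion (IwasawaAlgebra p) X.X)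

/-- **REGISTERED STUB (v3) `stub_envelope` — the Heegner-module ENVELOPE**: from the tower containment
(`PrintX9.AnticyclotomicTowerInRingClassFields`, needed to BUILD `C`), on every light X9 Heegner frame, for
the GIVEN `jbar` and EVERY `Λ`-adic Selmer datum `D` (`𝔖_p(K_∞)`), there are a `d(k)`-shifted stabilised
datum `C`, a tree Heegner family `F₀` on the frame's parametrisation datum (`F₀.Dt = Dt`) and `e : ℕ` with
`(p^e) · I(ℋ_{F₀}) ⊆ I(Λκ_∞(C))` and `𝔖/ℋ_{F₀}` `Λ`-torsion. Content: `(p^e)·ℋ_{F₀} ⊆ Λκ_∞(C)` (vertical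
distribution relations `Tr P[p^{d+1}] = a_p P[p^d] − P[p^{d-1}]`: `z_k = A_δ α^{d(k)} κ_k + α^{-1}β^δ v_k`,
lower layers are partial norms of `κ_k`, the `E(K_δ)`-components of a norm-compatible system vanish;
`e = 0` expected) + monotonicity / multiplicativity of `char` on torsion quotients + the rank-one bound
`char(ℋ_{F₀}/p^eℋ_{F₀}) ⊇ (p^e)` + non-torsion of the `Λ`-adic Heegner class (CGLS Thm. 4.1.1 via
Cornut–Vatsal; Perrin-Riou Prop. 10). Beyond TYPED print (Darmon Prop. 3.10 is cite-only in the
`ringClassField` vocabulary; CGLS 4.1.1's `κ₁^{Hg} ≠ 0` is not exported by p596552); size L.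
[cite: CastellaGrossiLeeSkinner2022, Thm. 4.1.1, Rem. 4.1.4 (arXiv:2008.02571)] [cite: PerrinRiou1987BSMF, §3.3 (distribution relations), §3.4 Prop. 10]
[cite: Darmon2004, Prop. 3.10] [cite: Cornut2002] -/
def Stmt.stub_envelope : Prop :=
    Summit.BirchSwinnertonDyer.BirchSwinnertonDyer.Theses.PrintX9.AnticyclotomicTowerInRingClassFields →
    ∀ (W : WeierstrassCurve ℚ) [W.IsElliptic] [W.IsGloballyMinimal] (p : ℕ) [Fact p.Prime]
      [NeZero (W.conductorNorm ℤ)] (K : Type) [Field K] [NumberField K],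
      Summit.BirchSwinnertonDyer.BirchSwinnertonDyer.Rank1Residual.ClassX9 W p →
      IsImaginaryQuadratic K → Odd (NumberField.discr K) → NumberField.discr K ≠ -3 →
      SatisfiesHeegnerHypothesis (W.conductorNorm ℤ) K → SatisfiesHeegnerHypothesis p K →
      (W.baseChange K).HasIrreducibleModPGaloisRep p →
      ∀ (κ : ZpExtension K p), κ.IsAnticyclotomic → ∀ (γ : Field.absoluteGaloisGroup K),
      κ.IsTopGenerator γ →
      ∀ (Dt : ModularForms.ModularParametrizationData W (W.conductorNorm ℤ))
        (H : HeegnerDatum (W.conductorNorm ℤ) (NumberField.discr K))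
        (jbar : AlgebraicClosure K →+* ℂ) (D : (W.baseChange K).LambdaAdicSelmerData κ γ),
      ∃ (C : CastellaGrossiLeeSkinner2022.StabilizedHeegnerData (W.conductorNorm ℤ) W K κ jbar)
        (F₀ : HeegnerFamily (W.conductorNorm ℤ) W K κ jbar) (e : ℕ),
        F₀.Dt = Dt ∧
        Ideal.span {((p : IwasawaAlgebra p) ^ e)} * heegnerCharIdeal D F₀ ≤
          CastellaGrossiLeeSkinner2022.stabilizedHeegnerCharIdeal D C ∧
        Module.IsTorsion (IwasawaAlgebra p) (D.S ⧸ heegnerModule D F₀)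

/-- **REGISTERED STUB (v3) `stub_rescaling` — μ-BLIND promotion AS TYPED**: on a light X9 Heegner frame,
for the GIVEN `jbar`, a `Λ`-adic Selmer datum `D` with `𝔖` finitely generated of `Λ`-rank one (CGLS
4.1.3, first clause), a tree Heegner family `F₀` with `𝔖/ℋ_{F₀}` torsion and a Selmer dual `X`: the
LOCALIZED containment `(p^m)·I(ℋ_{F₀})² ⊆ char_Λ(X_tors)` yields a family `F` (namely `p^b • F₀`,
`2b ≥ m`: `HeegnerFamily.zsmul`) with the INTEGRAL containment `I(ℋ_F)² ⊆ char_Λ(X_tors)`. Steps: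
`E(K_k)[p] = 0` along the anticyclotomic tower from (irr) ⇒ `𝔖` has no `p`-torsion and levelwise
`p^b`-division lifts to `𝔖` (x9-p1-w2 p607645) ⇒ `ℋ(p^b•F₀) ⊆ (C p^b)•ℋ(F₀)`; `char(𝔖/ℋ(p^b•F₀)) ⊆
char(𝔖/p^bℋ₀) = I(ℋ₀)·char(ℋ₀/p^bℋ₀) ⊆ (p^b)·I(ℋ₀)` (monotonicity and multiplicativity of `char` on
finitely generated torsion modules; `char(M/p^bM) ⊆ (p^b)` for `M` with a non-torsion element and no
`p`-torsion, x9-p1-w2 p607664). Typing, size M–L. Kernel-valid as typed; NOT route currency under PIN-1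
(plan g9 R0) — the pinned twin of this stub is the μ-part, beyond print at `p ∣ h_K`.
[cite: Howard2004HeegnerKolyvagin, §3.3 (H_k, 𝐇)] [cite: PerrinRiou1987BSMF, §0 p. 402, §1 p. 405]
[cite: NeukirchSchmidtWingberg2008, Ch. V §3 (multiplicativity of characteristic ideals)] -/
def Stmt.stub_rescaling : Prop :=
    ∀ (W : WeierstrassCurve ℚ) [W.IsElliptic] [W.IsGloballyMinimal] (p : ℕ) [Fact p.Prime]
      [NeZero (W.conductorNorm ℤ)] (K : Type) [Field K] [NumberField K],
      Summit.BirchSwinnertonDyer.BirchSwinnertonDyer.Rank1Residual.ClassX9 W p →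
      IsImaginaryQuadratic K → Odd (NumberField.discr K) → NumberField.discr K ≠ -3 →
      SatisfiesHeegnerHypothesis (W.conductorNorm ℤ) K → SatisfiesHeegnerHypothesis p K →
      (W.baseChange K).HasIrreducibleModPGaloisRep p →
      ∀ (κ : ZpExtension K p), κ.IsAnticyclotomic → ∀ (γ : Field.absoluteGaloisGroup K),
      κ.IsTopGenerator γ →
      ∀ (jbar : AlgebraicClosure K →+* ℂ) (D : (W.baseChange K).LambdaAdicSelmerData κ γ)
        (F₀ : HeegnerFamily (W.conductorNorm ℤ) W K κ jbar) (X : (W.baseChange K).SelmerDualData κ γ),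
      Module.Finite (IwasawaAlgebra p) D.S → Module.finrank (IwasawaAlgebra p) D.S = 1 →
      Module.IsTorsion (IwasawaAlgebra p) (D.S ⧸ heegnerModule D F₀) →
      (∃ m : ℕ, Ideal.span {((p : IwasawaAlgebra p) ^ m)} * heegnerCharIdeal D F₀ ^ 2 ≤
        Module.charIdeal (IwasawaAlgebra p) (Submodule.torsion (IwasawaAlgebra p) X.X)) →
      ∃ (F : HeegnerFamily (W.conductorNorm ℤ) W K κ jbar),
        heegnerCharIdeal D F ^ 2 ≤
          Module.charIdeal (IwasawaAlgebra p) (Submodule.torsion (IwasawaAlgebra p) X.X)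

/-! ## The p ∤ h_K regime, PROVED from MZ26 Cor. 4.6 by name (the former stub 1; no `sorry`) -/

/-- **Mastella–Zerman 2026 Cor. 4.6 gives Howard's containment at every light X9 frame with `p ∤ h_K`, for the
GIVEN `jbar`** (the data produced from the tree's existence theorems; MZ26's hypothesis structure from the leaf
predicate via `Rank1Residual.ClassX9.mz26Hypotheses`, the scalar condition a theorem). [cite: MastellaZerman2026, Cor. 4.6]
[cite: LombardoTronto2022, Thm. 3.16] [cite: PerrinRiou1987BSMF, §0] [cite: GreenbergLNM1716, §1] -/
theorem coprimeClassNumber_of_cor46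
    (h46 : MastellaZerman2026.cor46_howardDivisibility_of_scalarImage.{0}) :
    Stmt.coprimeClassNumber :=
  -- ty3 g14 p596622 (ACCEPTED 02:15Z): the light line's stub 1 BY SIGNATURE for the given `jbar`, modulo h46
  -- (`X9.heegnerContainmentAt_of_cor46`: data by the tree's existence theorems, MZ26 Cor 4.6 AT jbar via
  -- `MastellaZerman2026.conclusion_of_cor46` + `ClassX9.mz26Hypotheses`); the definiens is verbatim ours.
  Summit.BirchSwinnertonDyer.Rank1Residual.X9.torsionDepthLight_stub_coprimeClassNumber_of_cor46 h46

/-! ## The stubs (the ONLY sorries of the file) -/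

theorem stub_envelope : Stmt.stub_envelope := by
  sorry

theorem stub_rescaling : Stmt.stub_rescaling := by
  sorry

/-! ## Composition (kernel-checked, no `sorry` outside the stubs) -/

/-- Ideal bookkeeping: `(a) · ((b) · I)² = (a·b²) · I²`. [folklore] -/
theorem span_singleton_mul_sq {R : Type*} [CommSemiring R] (a b : R) (I : Ideal R) :
    Ideal.span {a} * (Ideal.span {b} * I) ^ 2 = Ideal.span {a * b ^ 2} * I ^ 2 := by
  rw [mul_pow, Ideal.span_singleton_pow, ← mul_assoc, Ideal.span_singleton_mul_span_singleton]

/-- **The two stubs give the crux BY NAME**: introduce `h46` (MZ26 Cor. 4.6), `hCGLS` (CGLS22 Thm. 4.1.3),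
`hTw` (tower containment); fix the frame; `jbar := IsAlgClosed.lift` along `ιC`; split on `p ∣ h_K`.
`p ∤ h_K`: PRINT (`coprimeClassNumber_of_cor46 h46`). `p ∣ h_K`: `𝔖_p(K_∞)` and `X` exist
(`nonempty_lambdaAdicSelmerData`, `nonempty_selmerDualData_holds`); `stub_envelope hTw` gives `(C, F₀, e)`;
CGLS 4.1.3 BY NAME at `(D, C, X)` (hypotheses by x9-p2's `X9.thm413Hypotheses_of_lightFrame`, corank one by
`X9.selmerCorank_eq_one_of_rank_one`) gives `𝔖` f.g. of rank one and `(p^m)·I(Λκ_∞(C))² ⊆ char(X_tors)`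
(`span_pow_mul_sq_le_charIdeal_torsion_of_thm413`), whence `(p^{m}·p^{2e})·I(ℋ_{F₀})² ⊆ char(X_tors)`;
`stub_rescaling` gives the family. -/
theorem HowardContainmentLightFrameOfPrint_of
    (h_env : Stmt.stub_envelope) (h_resc : Stmt.stub_rescaling) :
    Summit.BirchSwinnertonDyer.BirchSwinnertonDyer.Theses.PrintX9.HowardContainmentLightFrameOfPrint := by
  intro h46 hCGLS hTw
  have h₁ := coprimeClassNumber_of_cor46 h46
  unfold Stmt.coprimeClassNumber at h₁
  unfold Stmt.stub_envelope at h_env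
  unfold Stmt.stub_rescaling at h_resc
  intro W _ _ p _ _ K _ _ hX9 hK hodd h3 hHN hHp hirr κ hκ γ hγ Dt H ιC hrk hfin
  letI : Algebra K ℂ := ιC.toAlgebra
  let jbar : AlgebraicClosure K →+* ℂ :=
    (IsAlgClosed.lift (R := K) (M := ℂ) (S := AlgebraicClosure K)).toRingHom
  by_cases hh : p ∣ NumberField.classNumber K
  · -- the data exist
    obtain ⟨D⟩ :=
      WeierstrassCurve.LambdaAdicSelmerDataExists.nonempty_lambdaAdicSelmerData (W.baseChange K) p κ hγ
    obtain ⟨X⟩ := (W.baseChange K).nonempty_selmerDualData_holds κ γ hγ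
    -- the envelope: `C`, `F₀`, `e`
    obtain ⟨C, F₀, e, -, henv, htor⟩ :=
      h_env hTw W p K hX9 hK hodd h3 hHN hHp hirr κ hκ γ hγ Dt H jbar D
    -- CGLS Thm. 4.1.3 BY NAME at `(D, C, X)`
    have hX9c :=
      Summit.BirchSwinnertonDyer.BirchSwinnertonDyer.Rank1Residual.classX9_census_of_classX9 W p hX9
    have hyp := Summit.BirchSwinnertonDyer.Rank1Residual.X9.thm413Hypotheses_of_lightFrame hX9c hK hodd
      h3 hHN hHp hκ hγ
    have hrk1 := Summit.BirchSwinnertonDyer.Rank1Residual.X9.selmerCorank_eq_one_of_rank_one hrk hfin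
    have h413 : CastellaGrossiLeeSkinner2022.thm413_rankOne_charIdeal_torsion_dvd_localized.{0} := hCGLS
    obtain ⟨⟨hfinS, hrankS⟩, -⟩ := h413 (W.conductorNorm ℤ) W K p κ γ jbar hyp D C X
    obtain ⟨m, hm⟩ :=
      CastellaGrossiLeeSkinner2022.span_pow_mul_sq_le_charIdeal_torsion_of_thm413 h413 hyp hrk1 D C X
    -- `p^{m+2e} · I(ℋ_{F₀})² ⊆ char(X_tors)`
    have hloc : Ideal.span {((p : IwasawaAlgebra p) ^ (m + e * 2))} * heegnerCharIdeal D F₀ ^ 2 ≤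
        Module.charIdeal (IwasawaAlgebra p) (Submodule.torsion (IwasawaAlgebra p) X.X) := by
      calc Ideal.span {((p : IwasawaAlgebra p) ^ (m + e * 2))} * heegnerCharIdeal D F₀ ^ 2
          = Ideal.span {((p : IwasawaAlgebra p) ^ m)} *
              (Ideal.span {((p : IwasawaAlgebra p) ^ e)} * heegnerCharIdeal D F₀) ^ 2 := by
            rw [span_singleton_mul_sq, ← pow_mul, ← pow_add]
        _ ≤ Ideal.span {((p : IwasawaAlgebra p) ^ m)} *
              CastellaGrossiLeeSkinner2022.stabilizedHeegnerCharIdeal D C ^ 2 :=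
            Ideal.mul_mono_right (Ideal.pow_right_mono henv 2)
        _ ≤ _ := hm
    obtain ⟨F, hF⟩ := h_resc W p K hX9 hK hodd h3 hHN hHp hirr κ hκ γ hγ jbar D F₀ X hfinS hrankS htor
      ⟨m + e * 2, hloc⟩
    exact ⟨jbar, D, F, X, hF⟩
  · obtain ⟨D, F, X, hc⟩ := h₁ W p K hX9 hK hodd h3 hHN hHp hirr κ hκ γ hγ Dt H ιC jbar hrk hfin hh
    exact ⟨jbar, D, F, X, hc⟩

/-- The composed line from the two stubs (sorries only through `stub_envelope`, `stub_rescaling`). -/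
theorem HowardContainmentLightFrameOfPrint_of_stubs :
    Summit.BirchSwinnertonDyer.BirchSwinnertonDyer.Theses.PrintX9.HowardContainmentLightFrameOfPrint :=
  HowardContainmentLightFrameOfPrint_of stub_envelope stub_rescaling

/-- Sanity (kernel): any proof of 24424 `HowardContainmentLightFrame` gives this crux outright. -/
theorem HowardContainmentLightFrameOfPrint_of_lightFrame
    (h : Summit.BirchSwinnertonDyer.BirchSwinnertonDyer.Theses.PrintX9.HowardContainmentLightFrame) :
    Summit.BirchSwinnertonDyer.BirchSwinnertonDyer.Theses.PrintX9.HowardContainmentLightFrameOfPrint :=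
  fun _ _ _ => h

end Summit.BirchSwinnertonDyer.BirchSwinnertonDyer.Cruxes.HowardContainmentLightFrameOfPrint.TorsionDepthLight
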